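import Summits.BirchSwinnertonDyer.BirchSwinnertonDyer.Theorems.AdditiveKolyvaginRoadTwoPlaceLagrangian
import HarnessLib

/-!
# Route `AdditiveKolyvaginRoad`, crux `LevelKolyvaginSystemsAdditive` (item stmt-BirchSwinnertonDyer-21396, KS′):
# the ONE-PLACE relaxed Kummer group has LAGRANGIAN image in `H¹(K_v, E[p])` at ANY finite place `v` — count and jump,
# in particular at the places ABOVE `p` (the E-side input (T-A1p) of the transfer socket's three-Lagrangian switch)
# (cell `pub/bsd-wall`, width seat `bsd-wall-akr-p2x-w3` g3; `--supports stmt-BirchSwinnertonDyer-21396`, helper)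

WHY. The TRANSFER-type lines on KS′ (crux ideas `depleted-shadow-transfer` ∕ `pold-fusion-glue` ∕ `epsilon-matched-retyping`,
triage survivor A; memo `SOCKETS-TRANSFER.md` S3 and «still owes (T-A1p)») identify the Kummer lines of two congruent curves at a
place `w ∣ p` through akr-p2x-w3 g0's route-free `…LagrangianSwitch` (`odd_finrank_add_of_switch`), whose inputs at `w` are: a
PLANE `H¹(K_w, E[p])`, the Kummer line Lagrangian (tree: `annRight_kummer_eq_P`), and a subgroup `loc_w(T)` that is TOTALLY
ISOTROPIC (Poitou–Tate reciprocity) and NON-ZERO (jump) for the `{w}`-relaxed Kummer group `T`. akr-p1 g5's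
`…TwoPlaceLagrangian` did this at TWO admissible places; akr-p2x g0's `…AdmissibleJump` at ONE admissible place above a level.
THIS FILE is the one-place version at an ARBITRARY finite place (so also at `w ∣ p`):
* `lagrangian_image_kummerOutside_single` — `Λ_v := loc_v(kummerOutside E p {v})` is isotropic AND maximal for
  `b_v = inv_v(· ∪ₑ ·)` (PT vanishing + Howard Thm. 2.1.11 via X11b `exists_mem_kummerOutside_localization_eq`, symmetrised);
* `annRight_image_kummerOutside_single_eq`, `natCard_image_kummerOutside_single_mul_self` (`#Λ_v² = #H¹(K_v, E[p])`),
  `natCard_image_kummerOutside_single_eq` (`#Λ_v = #E(K_v)[p] · #(𝓞_v ⧸ p)`, Tate's local Euler–Poincaré characteristic,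
  PROVED in the tree: `localEulerPoincareCharacteristic_holds`);
* `one_lt_natCard_quotient_span_of_mem` (`#(𝓞_v ⧸ p) > 1` at `v ∣ p`) and the JUMP
  `exists_mem_kummerOutside_single_notMem_torsionLocalKer_of_dvd`: at every place `v ∣ p` of an imaginary quadratic `K`, granted
  `poitouTate_selmerStructure_duality K`, some class Kummer at every place `≠ v` is NOT locally trivial at `v`.

HONEST FRAMING: theorems only; 0 definitions, 0 named facts, 0 `sorry`; §1–§2 CONDITIONAL on the properties `IsPerfect`,
`SumLocalTermEqZero`, `SelmerComplement` of a Poitou–Tate family `inv` (the content of the named fact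
`poitouTate_selmerStructure_duality`, supplied by name in §3); closes nothing; no transfer line is registered yet — this is the
place-agnostic E-side brick such a line would cite. BSD is not proved by any of this.

References: [cite: MilneADT2006, Ch. I, Cor. 2.3, Thm. 2.8, Thm. 4.10] [cite: Howard2004HeegnerKolyvagin, Thm. 2.1.11]
[cite: WZhang2014, Lemma 5.3] [cite: PoonenRains2012, Prop. 4.10].
-/

-- single-conjunct summit: `Summit.BirchSwinnertonDyer.BirchSwinnertonDyer.…` repeats the name by design
set_option linter.dupNamespace false

noncomputable section

open scoped Classical NumberField
open Function NumberField IsDedekindDomain Field WeierstrassCurve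
open Literature.NumberTheory.EllipticCurves Literature.NumberTheory.EllipticCurves.ModularForms
open Literature.NumberTheory.GaloisRepresentations Literature.NumberTheory.GaloisRepresentations.DiscreteGaloisModule
  Literature.NumberTheory.GaloisCohomology
open Summit.BirchSwinnertonDyer.Rank1Residual.X11b.FiniteDuality
open Summit.BirchSwinnertonDyer.Rank1Residual.X11b.Relaxation
open Summit.BirchSwinnertonDyer.Rank1Residual.X11b
open Summit.BirchSwinnertonDyer.Rank1Residual.GaloisImage
open Summit.BirchSwinnertonDyer.Rank1Residual.X11b.Three.Koly.Method2

namespace Summit.BirchSwinnertonDyer.BirchSwinnertonDyer.Theorems.AdditiveKoly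

/-! ## §1 The image of the `{v}`-relaxed Kummer group in `H¹(K_v, E[p])` is Lagrangian -/

section OnePlace

variable (W : WeierstrassCurve ℚ) (K : Type) [Field K] [NumberField K] (p : ℕ) [W.IsElliptic] [Fact p.Prime]
variable (e : geomTorsion (W.baseChange K) ((p ^ 1 : ℕ) : ℤ) → geomTorsion (W.baseChange K) ((p ^ 1 : ℕ) : ℤ) →
    AlgebraicClosure K)
  (hμ : ∀ P Q, e P Q ^ (p ^ 1) = 1) (hadd₁ : ∀ P₁ P₂ Q, e (P₁ + P₂) Q = e P₁ Q * e P₂ Q)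
  (hadd₂ : ∀ P Q₁ Q₂, e P (Q₁ + Q₂) = e P Q₁ * e P Q₂) (halt : ∀ Q, e Q Q = 1)
  (hnondeg : ∀ Q, (∀ P, e P Q = 1) → Q = 0)
  (hgal : ∀ (σ : absoluteGaloisGroup K) (P Q : geomTorsion (W.baseChange K) ((p ^ 1 : ℕ) : ℤ)),
    σ • e P Q = e (σ • P) (σ • Q))
  (inv : LocalInvariants K (p ^ 1))

include halt hnondeg in
/-- **THE `{v}`-RELAXED KUMMER GROUP HAS LAGRANGIAN IMAGE at ANY finite place `v`** (`K` imaginary quadratic, `inv` a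
Poitou–Tate family at level `p`): for `Λ_v := loc_v(kummerOutside E p {v}) ≤ H¹(K_v, E[p])`, (isotropy) `b_v(l, l′) = 0`
on `Λ_v` (Poitou–Tate vanishing of the ONE-term sum + Kummer isotropy off `v`) and (maximality) every `t` with `b_v(l, t) = 0`
for all `l ∈ Λ_v` lies in `Λ_v` (Howard Thm. 2.1.11 for `kummerStrict ≤ kummerRelaxed`, X11b
`exists_mem_kummerOutside_localization_eq`, after symmetrising). One-place twin of akr-p1 g5's
`lagrangian_image_kummerOutside_pair`. [cite: MilneADT2006, Ch. I, Thm. 4.10] [cite: Howard2004HeegnerKolyvagin, Thm. 2.1.11] -/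
theorem lagrangian_image_kummerOutside_single
    [∀ v : Place K, CompactSpace (absoluteGaloisGroup (Place.Completion v))]
    [Finite (geomTorsion (W.baseChange K) ((p ^ 1 : ℕ) : ℤ))]
    (hK : IsImaginaryQuadratic K) (hperf : inv.IsPerfect)
    (hsum : inv.SumLocalTermEqZero) (hcompl : inv.SelmerComplement) (v : HeightOneSpectrum (𝓞 K)) :
    let Λ := (kummerOutside (W.baseChange K) (p ^ 1) ({Sum.inr v} : Finset (Place K))).map
      (galoisCohomology.localization ((W.baseChange K).torsionGaloisModule ((p ^ 1 : ℕ) : ℤ)) (Sum.inr v) 1)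
    (∀ l ∈ Λ, ∀ l' ∈ Λ, invWeilPairing (W.baseChange K) (p ^ 1) e hμ hadd₁ hadd₂ hgal inv (Sum.inr v) l l' = 0) ∧
      (∀ t, (∀ l ∈ Λ, invWeilPairing (W.baseChange K) (p ^ 1) e hμ hadd₁ hadd₂ hgal inv (Sum.inr v) l t = 0) → t ∈ Λ) := by
  intro Λ
  have hp : p.Prime := Fact.out
  haveI : NeZero (p ^ 1 : ℕ) := ⟨pow_ne_zero 1 hp.ne_zero⟩
  set S' : Finset (Place K) := {Sum.inr v} with hS'
  set loc := galoisCohomology.localization ((W.baseChange K).torsionGaloisModule ((p ^ 1 : ℕ) : ℤ)) (Sum.inr v) 1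
    with hloc
  -- the Poitou–Tate sum over `S' = {v}` is the one-term sum
  have hsum1 : ∀ (f : Place K → ZMod (p ^ 1)), ∑ u ∈ S', f u = f (Sum.inr v) := fun f ↦
    Finset.sum_singleton f (Sum.inr v)
  refine ⟨?_, ?_⟩
  · rintro _ ⟨y, hy, rfl⟩ _ ⟨z, hz, rfl⟩
    have h := KummerPT.sum_invWeilPairing_localization_eq_zero_of_mem_kummerOutside (W.baseChange K) (p ^ 1) e hμ
      hadd₁ hadd₂ hgal halt inv hsum S' hy hz
    rw [hsum1] at h
    exact h
  · intro t ht
    have hp1 : IsPrimePow (p ^ 1 : ℕ) := hp.isPrimePow.pow one_ne_zero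
    have hEuler : ∀ u : HeightOneSpectrum (𝓞 K),
        Nat.card (galoisCohomology (((W.baseChange K).torsionGaloisModule ((p ^ 1 : ℕ) : ℤ)).toLocal (Sum.inr u)) 1) =
          (Nat.card (nsmulAddMonoidHom (p ^ 1) :
              ((W.baseChange K).baseChange (u.adicCompletion K)).toAffine.Point →+ _).ker *
            Nat.card (u.adicCompletionIntegers K ⧸
              Ideal.span {((p ^ 1 : ℕ) : u.adicCompletionIntegers K)})) ^ 2 := fun u ↦ by
      haveI : CharZero (u.adicCompletion K) := charZero_of_injective_algebraMap (algebraMap K _).injective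
      exact natCard_galoisCohomology_one_torsion_adicCompletion_eq_sq (W.baseChange K) u (p ^ 1) hp1
        (localEulerPoincareCharacteristic_holds (u.adicCompletion K))
    -- the test family: `t` at `v`, zero elsewhere
    let t' : Π u : Place K, galoisCohomology (((W.baseChange K).torsionGaloisModule ((p ^ 1 : ℕ) : ℤ)).toLocal u) 1 :=
      fun u ↦ if h : u = Sum.inr v then h ▸ t else 0
    have ht' : t' (Sum.inr v) = t := by simp [t']
    obtain ⟨x, hx, hxt⟩ := KummerPT.exists_mem_kummerOutside_localization_eq (W.baseChange K) p 1 e hμ hadd₁ hadd₂ hgal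
      halt hnondeg (fun w ↦ hK.2.isComplex w) hperf hcompl hEuler S' t' (fun c hc ↦ by
        rw [hsum1, ht', invWeilPairing_symm_P W K p e hμ hadd₁ hadd₂ halt hgal inv (Sum.inr v)]
        exact ht (loc c) ⟨c, hc, rfl⟩)
    refine ⟨x, hx, ?_⟩
    have h := hxt (Sum.inr v) (by simp [hS'])
    rw [ht'] at h
    exact h

include halt hnondeg in
/-- **`Λ_v` is its own annihilator** (`annRight b_v Λ_v = Λ_v`): isotropy + maximality. [cite: MilneADT2006, Ch. I, Thm. 4.10] -/
theorem annRight_image_kummerOutside_single_eq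
    [∀ v : Place K, CompactSpace (absoluteGaloisGroup (Place.Completion v))]
    [Finite (geomTorsion (W.baseChange K) ((p ^ 1 : ℕ) : ℤ))]
    (hK : IsImaginaryQuadratic K) (hperf : inv.IsPerfect)
    (hsum : inv.SumLocalTermEqZero) (hcompl : inv.SelmerComplement) (v : HeightOneSpectrum (𝓞 K)) :
    annRight (invWeilPairing (W.baseChange K) (p ^ 1) e hμ hadd₁ hadd₂ hgal inv (Sum.inr v))
      ((kummerOutside (W.baseChange K) (p ^ 1) ({Sum.inr v} : Finset (Place K))).map
        (galoisCohomology.localization ((W.baseChange K).torsionGaloisModule ((p ^ 1 : ℕ) : ℤ)) (Sum.inr v) 1)) =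
      (kummerOutside (W.baseChange K) (p ^ 1) ({Sum.inr v} : Finset (Place K))).map
        (galoisCohomology.localization ((W.baseChange K).torsionGaloisModule ((p ^ 1 : ℕ) : ℤ)) (Sum.inr v) 1) := by
  obtain ⟨hiso, hmax⟩ := lagrangian_image_kummerOutside_single W K p e hμ hadd₁ hadd₂ halt hnondeg hgal inv hK hperf hsum
    hcompl v
  ext t
  rw [mem_annRight_iff]
  exact ⟨fun h ↦ hmax t h, fun h l hl ↦ hiso l hl t h⟩

include hμ hadd₁ hadd₂ halt hnondeg hgal in
/-- **`#Λ_v · #Λ_v = #H¹(K_v, E[p])`** (a Lagrangian of the local Tate pairing has half the logarithmic size).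
[cite: MilneADT2006, Ch. I, Cor. 2.3, Thm. 4.10] -/
theorem natCard_image_kummerOutside_single_mul_self
    [∀ v : Place K, CompactSpace (absoluteGaloisGroup (Place.Completion v))]
    [Finite (geomTorsion (W.baseChange K) ((p ^ 1 : ℕ) : ℤ))]
    (hK : IsImaginaryQuadratic K) (hperf : inv.IsPerfect)
    (hsum : inv.SumLocalTermEqZero) (hcompl : inv.SelmerComplement) (v : HeightOneSpectrum (𝓞 K)) :
    Nat.card ((kummerOutside (W.baseChange K) (p ^ 1) ({Sum.inr v} : Finset (Place K))).map
        (galoisCohomology.localization ((W.baseChange K).torsionGaloisModule ((p ^ 1 : ℕ) : ℤ)) (Sum.inr v) 1)) *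
      Nat.card ((kummerOutside (W.baseChange K) (p ^ 1) ({Sum.inr v} : Finset (Place K))).map
        (galoisCohomology.localization ((W.baseChange K).torsionGaloisModule ((p ^ 1 : ℕ) : ℤ)) (Sum.inr v) 1)) =
      Nat.card (galoisCohomology (((W.baseChange K).torsionGaloisModule ((p ^ 1 : ℕ) : ℤ)).toLocal (Sum.inr v)) 1) := by
  have hp : p.Prime := Fact.out
  haveI : NeZero (p ^ 1 : ℕ) := ⟨pow_ne_zero 1 hp.ne_zero⟩
  exact natCard_mul_self_eq_of_annRight_eq W K p e hμ hadd₁ hadd₂ hnondeg hgal inv v (hperf v).1.1 _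
    (annRight_image_kummerOutside_single_eq W K p e hμ hadd₁ hadd₂ halt hnondeg hgal inv hK hperf hsum hcompl v)

include hμ hadd₁ hadd₂ halt hnondeg hgal in
/-- **`#Λ_v = #E(K_v)[p] · #(𝓞_v ⧸ p)`** at ANY finite place `v`: the square root of Tate's local Euler–Poincaré count
`#H¹(K_v, E[p]) = (#E(K_v)[p] · #(𝓞_v ⧸ p))²` (tree `natCard_galoisCohomology_one_torsion_adicCompletion_eq_sq` with the PROVED
`localEulerPoincareCharacteristic_holds`). At `v ∤ p` this is `#E(K_v)[p]`; at `v ∣ p` the factor `#(𝓞_v ⧸ p) = p^{[K_v:ℚ_p]}`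
is the new one. [cite: MilneADT2006, Ch. I, Thm. 2.8] -/
theorem natCard_image_kummerOutside_single_eq
    [∀ v : Place K, CompactSpace (absoluteGaloisGroup (Place.Completion v))]
    [Finite (geomTorsion (W.baseChange K) ((p ^ 1 : ℕ) : ℤ))]
    (hK : IsImaginaryQuadratic K) (hperf : inv.IsPerfect)
    (hsum : inv.SumLocalTermEqZero) (hcompl : inv.SelmerComplement) (v : HeightOneSpectrum (𝓞 K)) :
    Nat.card ((kummerOutside (W.baseChange K) (p ^ 1) ({Sum.inr v} : Finset (Place K))).map
        (galoisCohomology.localization ((W.baseChange K).torsionGaloisModule ((p ^ 1 : ℕ) : ℤ)) (Sum.inr v) 1)) =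
      Nat.card (nsmulAddMonoidHom (p ^ 1) :
          ((W.baseChange K).baseChange (v.adicCompletion K)).toAffine.Point →+ _).ker *
        Nat.card (v.adicCompletionIntegers K ⧸ Ideal.span {((p ^ 1 : ℕ) : v.adicCompletionIntegers K)}) := by
  have hp : p.Prime := Fact.out
  have hp1 : IsPrimePow (p ^ 1 : ℕ) := hp.isPrimePow.pow one_ne_zero
  haveI : CharZero (v.adicCompletion K) := charZero_of_injective_algebraMap (algebraMap K _).injective
  have hEuler := natCard_galoisCohomology_one_torsion_adicCompletion_eq_sq (W.baseChange K) v (p ^ 1) hp1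
    (localEulerPoincareCharacteristic_holds (v.adicCompletion K))
  have hEuler' : Nat.card (galoisCohomology (((W.baseChange K).torsionGaloisModule ((p ^ 1 : ℕ) : ℤ)).toLocal
      (Sum.inr v)) 1) = _ := hEuler
  have h := natCard_image_kummerOutside_single_mul_self W K p e hμ hadd₁ hadd₂ halt hnondeg hgal inv hK hperf hsum hcompl v
  rw [hEuler', ← sq] at h
  exact (Nat.pow_left_injective two_ne_zero) h

end OnePlace

/-! ## §2 The jump at one relaxed place ABOVE `p`, granted the named Poitou–Tate fact -/

section Jump

variable (W : WeierstrassCurve ℚ) (K : Type) [Field K] [NumberField K] (p : ℕ) [W.IsElliptic] [Fact p.Prime]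

omit [W.IsElliptic] in
/-- `#(𝓞_v ⧸ p^1) > 1` at a place `v ∣ p`: `p` lies in the maximal ideal of `𝓞_v`
(`algebraMap_mem_maximalIdeal_adicCompletionIntegers_iff`), so the quotient is finite (`card_quotient_span_natCast_ne_zero`)
and non-trivial. [folklore] -/
theorem one_lt_natCard_quotient_span_of_mem (v : HeightOneSpectrum (𝓞 K)) (hpv : ((p : ℕ) : 𝓞 K) ∈ v.asIdeal) :
    1 < Nat.card (v.adicCompletionIntegers K ⧸ Ideal.span {((p ^ 1 : ℕ) : v.adicCompletionIntegers K)}) := by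
  have hp : p.Prime := Fact.out
  have hne0 := LocalPoints.card_quotient_span_natCast_ne_zero v (pow_ne_zero 1 hp.ne_zero) (K := K)
  have hmax : ((p ^ 1 : ℕ) : v.adicCompletionIntegers K) ∈ IsLocalRing.maximalIdeal (v.adicCompletionIntegers K) := by
    rw [pow_one, ← map_natCast (algebraMap (𝓞 K) (v.adicCompletionIntegers K)) p]
    exact (HeightOneSpectrum.algebraMap_mem_maximalIdeal_adicCompletionIntegers_iff (v := v) (p : 𝓞 K)).mpr hpv
  have hne_top : Ideal.span {((p ^ 1 : ℕ) : v.adicCompletionIntegers K)} ≠ ⊤ := by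
    rw [Ne, Ideal.span_singleton_eq_top]
    exact (IsLocalRing.mem_maximalIdeal _).mp hmax
  have hnt : Nontrivial (v.adicCompletionIntegers K ⧸ Ideal.span {((p ^ 1 : ℕ) : v.adicCompletionIntegers K)}) :=
    Ideal.Quotient.nontrivial_iff.mpr hne_top
  haveI : Finite (v.adicCompletionIntegers K ⧸ Ideal.span {((p ^ 1 : ℕ) : v.adicCompletionIntegers K)}) :=
    Nat.finite_of_card_ne_zero hne0
  exact Finite.one_lt_card

/-- **THE JUMP AT ONE RELAXED PLACE ABOVE `p`** (`K` imaginary quadratic, the named fact `poitouTate_selmerStructure_duality K`):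
at every finite place `v ∣ p` there is a class of `H¹(K, E[p])` satisfying E's Kummer condition at EVERY place other than `v`
and NOT locally trivial at `v` — `#Λ_v = #E(K_v)[p] · #(𝓞_v ⧸ p) > 1` by §1. (At a Bertolini–Darmon admissible place this is
akr-p2x g0's `exists_relaxed_notMem_torsionLocalKer_of_admQ` with empty level; here the place divides `p`, where the transfer
socket's three-Lagrangian switch lives.) CONDITIONAL on the PT fact; closes nothing. [cite: WZhang2014, Lemma 5.3]
[cite: MilneADT2006, Ch. I, Thm. 2.8, Thm. 4.10] -/
theorem exists_mem_kummerOutside_single_notMem_torsionLocalKer_of_dvd (hK : IsImaginaryQuadratic K)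
    (hPT : poitouTate_selmerStructure_duality K) (v : HeightOneSpectrum (𝓞 K)) (hpv : ((p : ℕ) : 𝓞 K) ∈ v.asIdeal) :
    ∃ x ∈ kummerOutside (W.baseChange K) (p ^ 1) ({Sum.inr v} : Finset (Place K)),
      x ∉ (W.baseChange K).torsionLocalKer (v.adicCompletion K) ((p ^ 1 : ℕ) : ℤ) := by
  have hp : p.Prime := Fact.out
  haveI : NeZero (p ^ 1 : ℕ) := ⟨pow_ne_zero 1 hp.ne_zero⟩
  haveI : IsTotallyComplex K := hK.2
  haveI : ∀ u : Place K, CompactSpace (absoluteGaloisGroup (Place.Completion u)) := fun u ↦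
    absoluteGaloisGroup_compactSpace _
  haveI : Finite (geomTorsion (W.baseChange K) ((p ^ 1 : ℕ) : ℤ)) := finite_geomTorsion_of_neZero (W.baseChange K) (p ^ 1)
  obtain ⟨e, hμ, hadd₁, hadd₂, halt, hnondeg, hgal⟩ :=
    exists_weilPairing_holds (W.baseChange K) (p ^ 1) (by rw [pow_one]; exact hp.two_le) (by
      exact_mod_cast pow_ne_zero 1 hp.ne_zero)
  obtain ⟨inv, hperf, hsum, -, hcompl⟩ := hPT (p ^ 1)
  set loc := galoisCohomology.localization ((W.baseChange K).torsionGaloisModule ((p ^ 1 : ℕ) : ℤ)) (Sum.inr v) 1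
    with hloc
  set Λ := (kummerOutside (W.baseChange K) (p ^ 1) ({Sum.inr v} : Finset (Place K))).map loc with hΛ
  have hcard := natCard_image_kummerOutside_single_eq W K p e hμ hadd₁ hadd₂ halt hnondeg hgal inv hK hperf hsum hcompl v
  haveI := KummerPT.finite_galoisCohomology_toLocal_inr (W.baseChange K) (p ^ 1) v
  have hΛpos : 0 < Nat.card Λ := Nat.card_pos
  have hbig : 1 < Nat.card Λ := by
    rw [hΛ, hloc] at hΛpos ⊢
    rw [hcard] at hΛpos ⊢
    have ha : 0 < Nat.card (nsmulAddMonoidHom (p ^ 1) :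
        ((W.baseChange K).baseChange (v.adicCompletion K)).toAffine.Point →+ _).ker :=
      Nat.pos_of_ne_zero fun h0 ↦ by rw [h0, zero_mul] at hΛpos; exact lt_irrefl 0 hΛpos
    exact lt_of_lt_of_le (one_lt_natCard_quotient_span_of_mem K p v hpv) (Nat.le_mul_of_pos_left _ ha)
  -- a subgroup with more than one element has a non-zero element
  have hne : Λ ≠ ⊥ := by
    intro h
    rw [h, AddSubgroup.card_bot] at hbig
    exact lt_irrefl 1 hbig
  obtain ⟨⟨l, hlΛ⟩, hl0⟩ := AddSubgroup.ne_bot_iff_exists_ne_zero.mp hne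
  obtain ⟨x, hx, rfl⟩ := hlΛ
  refine ⟨x, hx, fun hx0 ↦ hl0 (Subtype.ext ?_)⟩
  rw [← ker_localization_eq_torsionLocalKer_P W K p v] at hx0
  exact hx0

end Jump

end Summit.BirchSwinnertonDyer.BirchSwinnertonDyer.Theorems.AdditiveKoly

end
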